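import Mathlib
import Summits.AnomalousDissipation.AnomalousDissipation.Theorems.ScalarAnomalySteadySourceFormal.Negative.ForcedModes
import Literature.Analysis.FunctionSpaces.TorusScalarTrigPoly
import Literature.Analysis.FluidPDE.PassiveScalarForcedClass
import HarnessLib

/-!
# Route LimitingAbsorption — support item `ScalarSectorLift` (stmt-AnomalousDissipation-2941), part A:
# continuous Fourier modes of a weak sourced scalar

First file of the proof of
`Summit.AnomalousDissipation.AnomalousDissipation.Theses.LimitingAbsorption.ScalarSectorLift`
(the two-and-a-half-dimensional lift of the scalar-sector witness). The analytic core of the lift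
is an *energy-class representative* of a weak solution `θ ∈ L^∞_t L²_x` of the sourced
advection–diffusion equation `∂ₜθ + u·∇θ = κΔθ + h` (steady source) over a bounded drift. It is
built on the Fourier side. This file fixes, for a global weak solution `θ` (class
`Torus.IsWeakScalarTransportForcedOn` on every horizon), the **modal right-hand side**
`B(s, k) = -4π²κ|k|² 𝓕θ(s)(k) - ∑ⱼ 2πi kⱼ 𝓕(θuⱼ)(s)(k) + 𝓕h(k)` and the **continuous modes**
`c(t, k) = 𝓕θ₀(k) + ∫_{(0,t]} B(s, k) ds` — both passed around as hypotheses `hB`, `hc` (no new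
definitions) — and proves:

* `ssl_integrableOn_modeRHS` — `B(·, k) ∈ L¹(0, T)` for every horizon;
* `ssl_continuousOn_mode` — `t ↦ c(t, k)` is continuous on `[0, ∞)`;
* `ssl_ae_mode_eq` — for a.e. `t ∈ (0,T)`: `θ(t) ∈ L²` and `𝓕θ(t)(k) = c(t,k)` for **all** `k`
  (the tree's modewise integral equation `forced_ae_mFourierCoeff_eq`, countably many modes);
* `ssl_mode_conj` — the reality condition `c(t,-k) = conj c(t,k)` (exactly, for every `t`);
* `ssl_mode_add` — additivity `c(t,k) = c(s,k) + ∫_{(s,t]} B(·,k)`;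
* `ssl_sum_sq_mode_le` / `ssl_summable_sq_mode` — the uniform `ℓ²` bound
  `∑ₖ ‖c(t,k)‖² ≤ C_T` for **every** `t ∈ [0,T]` (Bessel at a.e. time, then continuity of the
  finite partial sums: a continuous function bounded a.e. is bounded everywhere).

References: DiPerna–Lions 1989, §II.1 (weak solutions tested modewise); Robinson–Rodrigo–Sadowski
2016, Thm. 4.4 Step 3 / Lemma 4.1 (Fourier-side energy class bookkeeping); Grafakos 2014,
Prop. 3.2.6 (4), 3.2.7 (3).
-/

set_option linter.dupNamespace false

noncomputable section

open scoped BigOperators Topology ENNReal NNReal InnerProductSpace ComplexConjugate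
open Filter Set Function MeasureTheory UnitAddTorus Complex

namespace Summit.AnomalousDissipation.AnomalousDissipation.Theorems

open Literature.Analysis Literature.Analysis.FunctionSpaces Literature.Analysis.FunctionSpaces.Torus
open Literature.Analysis.FluidPDE Literature.Analysis.FluidPDE.Torus
open ScalarAnomalySteadySourceFormal.Negative

variable {d : Type*} [Fintype d]
variable {κ : ℝ} {u : ℝ → UnitAddTorus d → EuclideanSpace ℝ d} {hs θ₀ : UnitAddTorus d → ℝ}
  {θ : ℝ → UnitAddTorus d → ℝ} {B c : ℝ → (d → ℤ) → ℂ}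

/-! ### The modal right-hand side -/

/-- **Integrability of the modal right-hand side** `B(·, k)` on every `(0, T)` (the modes
`𝓕θ(·)(k)`, `𝓕(θuⱼ)(·)(k)` are integrable in time by Fubini, tree
`forced_integrableOn_mFourierCoeff(_mul_velocity)`). [folklore] -/
theorem ssl_integrableOn_modeRHS
    (hB : B = fun s k => -(((4 * Real.pi ^ 2 * κ * freqNormSq k : ℝ)) : ℂ) *
        mFourierCoeff (fun x => (θ s x : ℂ)) k -
      ∑ j, (2 * Real.pi * I * (k j)) * mFourierCoeff (fun x => ((θ s x * u s x j : ℝ) : ℂ)) k +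
        mFourierCoeff (fun x => (hs x : ℂ)) k)
    {T : ℝ} (hsol : IsWeakScalarTransportForcedOn T κ u (fun _ => hs) θ₀ θ) (k : d → ℤ) :
    IntegrableOn (fun s => B s k) (Ioo 0 T) := by
  classical
  haveI : IsFiniteMeasure ((volume : Measure ℝ).restrict (Ioo 0 T)) := ⟨by
    rw [Measure.restrict_apply_univ]; exact measure_Ioo_lt_top⟩
  rw [hB]
  exact ((((forced_integrableOn_mFourierCoeff hsol k).const_mul _).sub
    (integrable_finsetSum _ fun j _ =>
      (forced_integrableOn_mFourierCoeff_mul_velocity hsol k j).const_mul _)).add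
        (integrable_const _))

/-- Integrability of `B(·, k)` on every `(0, T]`. [folklore] -/
theorem ssl_integrableOn_modeRHS_Ioc
    (hB : B = fun s k => -(((4 * Real.pi ^ 2 * κ * freqNormSq k : ℝ)) : ℂ) *
        mFourierCoeff (fun x => (θ s x : ℂ)) k -
      ∑ j, (2 * Real.pi * I * (k j)) * mFourierCoeff (fun x => ((θ s x * u s x j : ℝ) : ℂ)) k +
        mFourierCoeff (fun x => (hs x : ℂ)) k)
    {T : ℝ} (hsol : IsWeakScalarTransportForcedOn T κ u (fun _ => hs) θ₀ θ) (k : d → ℤ) :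
    IntegrableOn (fun s => B s k) (Ioc 0 T) :=
  (integrableOn_Ioc_iff_integrableOn_Ioo (f := fun s => B s k)).2 (ssl_integrableOn_modeRHS hB hsol k)

/-- **The modal right-hand side is conjugate symmetric in the frequency**:
`B(s, -k) = conj B(s, k)` (reality of `θ`, `θuⱼ`, `h`: `𝓕f(-k) = conj 𝓕f(k)` with no
integrability hypothesis; `conj (2πi kⱼ) = -2πi kⱼ`). [folklore] -/
theorem ssl_modeRHS_conj
    (hB : B = fun s k => -(((4 * Real.pi ^ 2 * κ * freqNormSq k : ℝ)) : ℂ) *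
        mFourierCoeff (fun x => (θ s x : ℂ)) k -
      ∑ j, (2 * Real.pi * I * (k j)) * mFourierCoeff (fun x => ((θ s x * u s x j : ℝ) : ℂ)) k +
        mFourierCoeff (fun x => (hs x : ℂ)) k)
    (s : ℝ) (k : d → ℤ) : B s (-k) = conj (B s k) := by
  rw [hB]
  simp only [Pi.neg_apply, Int.cast_neg, map_add, map_sub, map_mul, map_neg, map_sum,
    Complex.conj_ofReal, Complex.conj_I, map_ofNat, map_intCast, freqNormSq_neg,
    mFourierCoeff_ofReal_comp]
  ring

/-! ### The continuous modes -/

/-- **Continuity of the modes**: `t ↦ c(t, k) = 𝓕θ₀(k) + ∫_{(0,t]} B(s,k) ds` is continuous on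
`[0, ∞)` (primitive of a locally integrable function). [folklore] -/
theorem ssl_continuousOn_mode
    (hB : B = fun s k => -(((4 * Real.pi ^ 2 * κ * freqNormSq k : ℝ)) : ℂ) *
        mFourierCoeff (fun x => (θ s x : ℂ)) k -
      ∑ j, (2 * Real.pi * I * (k j)) * mFourierCoeff (fun x => ((θ s x * u s x j : ℝ) : ℂ)) k +
        mFourierCoeff (fun x => (hs x : ℂ)) k)
    (hc : c = fun t k => mFourierCoeff (fun x => (θ₀ x : ℂ)) k + ∫ s in Ioc 0 t, B s k)
    (hsol : ∀ T, 0 < T → IsWeakScalarTransportForcedOn T κ u (fun _ => hs) θ₀ θ) (k : d → ℤ) :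
    ContinuousOn (fun t => c t k) (Ici 0) := by
  intro t₀ ht₀
  have hT : 0 < t₀ + 1 := by linarith [mem_Ici.1 ht₀]
  have hI : IntegrableOn (fun s => B s k) (Icc 0 (t₀ + 1)) :=
    (integrableOn_Icc_iff_integrableOn_Ioc (f := fun s => B s k)).2
      (ssl_integrableOn_modeRHS_Ioc hB (hsol _ hT) k)
  have hP : ContinuousOn (fun t => ∫ s in Ioc 0 t, B s k) (Icc 0 (t₀ + 1)) :=
    intervalIntegral.continuousOn_primitive hI
  have hcP : ContinuousOn (fun t => c t k) (Icc 0 (t₀ + 1)) := by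
    rw [hc]
    exact continuousOn_const.add hP
  have hmem : Icc 0 (t₀ + 1) ∈ 𝓝[Ici 0] t₀ := by
    have h1 : Ici (0 : ℝ) ∩ Iio (t₀ + 1) ⊆ Icc 0 (t₀ + 1) := fun t ht => ⟨ht.1, ht.2.le⟩
    exact Filter.mem_of_superset (inter_mem_nhdsWithin (Ici 0) (Iio_mem_nhds (by linarith))) h1
  exact (hcP t₀ ⟨mem_Ici.1 ht₀, by linarith⟩).mono_of_mem_nhdsWithin hmem

/-- **Additivity of the modes**: `c(t,k) = c(s,k) + ∫_{(s,t]} B(·,k)` for `0 ≤ s ≤ t`. [folklore] -/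
theorem ssl_mode_add
    (hB : B = fun s k => -(((4 * Real.pi ^ 2 * κ * freqNormSq k : ℝ)) : ℂ) *
        mFourierCoeff (fun x => (θ s x : ℂ)) k -
      ∑ j, (2 * Real.pi * I * (k j)) * mFourierCoeff (fun x => ((θ s x * u s x j : ℝ) : ℂ)) k +
        mFourierCoeff (fun x => (hs x : ℂ)) k)
    (hc : c = fun t k => mFourierCoeff (fun x => (θ₀ x : ℂ)) k + ∫ s in Ioc 0 t, B s k)
    (hsol : ∀ T, 0 < T → IsWeakScalarTransportForcedOn T κ u (fun _ => hs) θ₀ θ) (k : d → ℤ)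
    {s t : ℝ} (hs0 : 0 ≤ s) (hst : s ≤ t) :
    c t k = c s k + ∫ τ in Ioc s t, B τ k := by
  rcases eq_or_lt_of_le (hs0.trans hst) with ht | ht
  · have hs' : s = 0 := le_antisymm (ht.symm ▸ hst) hs0
    subst hs'
    rw [← ht]
    simp
  have hI : IntegrableOn (fun τ => B τ k) (Ioc 0 t) := ssl_integrableOn_modeRHS_Ioc hB (hsol t ht) k
  rw [hc]
  dsimp only
  rw [← Ioc_union_Ioc_eq_Ioc hs0 hst, setIntegral_union (Ioc_disjoint_Ioc_of_le le_rfl)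
    measurableSet_Ioc (hI.mono_set (Ioc_subset_Ioc_right hst))
    (hI.mono_set (Ioc_subset_Ioc_left hs0)), add_assoc]

/-- **Reality condition of the modes**: `c(t, -k) = conj c(t, k)` for every `t` (datum and modal
right-hand side are conjugate symmetric, and `∫ conj = conj ∫`). [folklore] -/
theorem ssl_mode_conj
    (hB : B = fun s k => -(((4 * Real.pi ^ 2 * κ * freqNormSq k : ℝ)) : ℂ) *
        mFourierCoeff (fun x => (θ s x : ℂ)) k -
      ∑ j, (2 * Real.pi * I * (k j)) * mFourierCoeff (fun x => ((θ s x * u s x j : ℝ) : ℂ)) k +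
        mFourierCoeff (fun x => (hs x : ℂ)) k)
    (hc : c = fun t k => mFourierCoeff (fun x => (θ₀ x : ℂ)) k + ∫ s in Ioc 0 t, B s k)
    (t : ℝ) (k : d → ℤ) : c t (-k) = conj (c t k) := by
  rw [hc]
  dsimp only
  rw [map_add, ← integral_conj, mFourierCoeff_ofReal_comp]
  congr 1
  refine integral_congr_ae (ae_of_all _ fun s => ?_)
  exact ssl_modeRHS_conj hB s k

/-- The modes form a conjugate-symmetric scalar coefficient family at every time. [folklore] -/
theorem ssl_isConjSymmScalar_mode
    (hB : B = fun s k => -(((4 * Real.pi ^ 2 * κ * freqNormSq k : ℝ)) : ℂ) *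
        mFourierCoeff (fun x => (θ s x : ℂ)) k -
      ∑ j, (2 * Real.pi * I * (k j)) * mFourierCoeff (fun x => ((θ s x * u s x j : ℝ) : ℂ)) k +
        mFourierCoeff (fun x => (hs x : ℂ)) k)
    (hc : c = fun t k => mFourierCoeff (fun x => (θ₀ x : ℂ)) k + ∫ s in Ioc 0 t, B s k)
    (t : ℝ) : IsConjSymmScalar (c t) :=
  fun k => ssl_mode_conj hB hc t k

/-- **The modes are the Fourier coefficients of the solution at a.e. time**: for a.e.
`t ∈ (0,T)`, `θ(t) ∈ L²(T^d)` and `𝓕θ(t)(k) = c(t,k)` for all `k ∈ ℤ^d` simultaneously (the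
modewise integral equation of the tree, `forced_ae_mFourierCoeff_eq`, over the countably many
modes). [folklore] -/
theorem ssl_ae_mode_eq
    (hB : B = fun s k => -(((4 * Real.pi ^ 2 * κ * freqNormSq k : ℝ)) : ℂ) *
        mFourierCoeff (fun x => (θ s x : ℂ)) k -
      ∑ j, (2 * Real.pi * I * (k j)) * mFourierCoeff (fun x => ((θ s x * u s x j : ℝ) : ℂ)) k +
        mFourierCoeff (fun x => (hs x : ℂ)) k)
    (hc : c = fun t k => mFourierCoeff (fun x => (θ₀ x : ℂ)) k + ∫ s in Ioc 0 t, B s k)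
    {T : ℝ} (hsol : IsWeakScalarTransportForcedOn T κ u (fun _ => hs) θ₀ θ)
    (hhs : Integrable hs volume) (hθ₀ : Integrable θ₀ volume) :
    ∀ᵐ t ∂(volume.restrict (Ioo 0 T)),
      MemLp (θ t) 2 volume ∧ ∀ k, mFourierCoeff (fun x => (θ t x : ℂ)) k = c t k := by
  have hall : ∀ᵐ t ∂(volume.restrict (Ioo 0 T)), ∀ k,
      mFourierCoeff (fun x => (θ t x : ℂ)) k = c t k := by
    rw [ae_all_iff]
    intro k
    filter_upwards [forced_ae_mFourierCoeff_eq hsol hhs hθ₀ k] with t ht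
    rw [ht, hc, hB]
  filter_upwards [hsol.ae_memLp_two, hall] with t h1 h2
  exact ⟨h1, h2⟩

/-! ### The uniform `ℓ²` bound at every time -/

/-- A continuous real function on `[0, T]` which is `≤ C` at a.e. time of `(0, T)` is `≤ C` at
every time of `[0, T]` (`T > 0`; Lebesgue measure charges open sets, Mathlib's
`Measure.eqOn_Icc_of_ae_eq` applied to `g` and `min g C`). [folklore] -/
theorem ssl_le_of_ae_le_of_continuousOn {g : ℝ → ℝ} {T C : ℝ} (hT : 0 < T)
    (hg : ContinuousOn g (Icc 0 T)) (hle : ∀ᵐ t ∂(volume.restrict (Ioo 0 T)), g t ≤ C) :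
    ∀ t ∈ Icc 0 T, g t ≤ C := by
  have hmin : ContinuousOn (fun t => min (g t) C) (Icc 0 T) :=
    (continuous_id.min continuous_const).comp_continuousOn hg
  have hae : (fun t => min (g t) C) =ᵐ[volume.restrict (Icc 0 T)] g := by
    rw [← restrict_Ioo_eq_restrict_Icc]
    filter_upwards [hle] with t ht
    exact min_eq_left ht
  have heq := Measure.eqOn_Icc_of_ae_eq (μ := volume) hT.ne hae hmin hg
  intro t ht
  have h := heq ht
  simp only at h
  rw [← h]
  exact min_le_right _ _

/-- **Bessel at a.e. time**: for a.e. `t ∈ (0,T)` and every `N`,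
`∑_{|k|≤N} ‖c(t,k)‖² ≤ C`, where `C` is the `L^∞_t L²_x` bound of the solution class. [folklore] -/
theorem ssl_ae_sum_sq_mode_le [DecidableEq d]
    (hB : B = fun s k => -(((4 * Real.pi ^ 2 * κ * freqNormSq k : ℝ)) : ℂ) *
        mFourierCoeff (fun x => (θ s x : ℂ)) k -
      ∑ j, (2 * Real.pi * I * (k j)) * mFourierCoeff (fun x => ((θ s x * u s x j : ℝ) : ℂ)) k +
        mFourierCoeff (fun x => (hs x : ℂ)) k)
    (hc : c = fun t k => mFourierCoeff (fun x => (θ₀ x : ℂ)) k + ∫ s in Ioc 0 t, B s k)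
    {T : ℝ} (hsol : IsWeakScalarTransportForcedOn T κ u (fun _ => hs) θ₀ θ)
    (hhs : Integrable hs volume) (hθ₀ : Integrable θ₀ volume) {C : ℝ≥0}
    (hC : ∀ᵐ t ∂(volume.restrict (Ioo 0 T)), ∫⁻ x, ‖θ t x‖ₑ ^ 2 ≤ C) :
    ∀ᵐ t ∂(volume.restrict (Ioo 0 T)), ∀ N : ℕ, ∑ k ∈ freqBall N, ‖c t k‖ ^ 2 ≤ (C : ℝ) := by
  filter_upwards [ssl_ae_mode_eq hB hc hsol hhs hθ₀, hC] with t ht hCt N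
  obtain ⟨hmem, hcoef⟩ := ht
  have h1 := sum_sq_norm_mFourierCoeff_le_integral_sq hmem N
  simp only [hcoef] at h1
  refine h1.trans ?_
  -- `∫ θ² = (∫⁻ ‖θ‖ₑ²).toReal ≤ C`
  have hint : Integrable (fun x => θ t x ^ 2) volume := by
    have := hmem.integrable_norm_pow two_ne_zero
    simpa only [Real.norm_eq_abs, sq_abs] using this
  rw [integral_eq_lintegral_of_nonneg_ae (ae_of_all _ fun x => sq_nonneg _) hint.aestronglyMeasurable]
  have h2 : ∫⁻ x, ENNReal.ofReal (θ t x ^ 2) = ∫⁻ x, ‖θ t x‖ₑ ^ 2 := by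
    refine lintegral_congr fun x => ?_
    rw [← Real.enorm_eq_ofReal (sq_nonneg _), ← sq_abs, ← Real.norm_eq_abs, enorm_pow, enorm_norm]
  rw [h2]
  exact ENNReal.toReal_le_coe_of_le_coe hCt

/-- **The uniform `ℓ²` bound at every time**: with `C` the `L^∞_t L²_x` bound of the class on
`(0,T)`, `∑_{|k|≤N} ‖c(t,k)‖² ≤ C` for **every** `t ∈ [0,T]` and every `N` (the finite partial
sums are continuous in `t`). [folklore] -/
theorem ssl_sum_sq_mode_le [DecidableEq d]
    (hB : B = fun s k => -(((4 * Real.pi ^ 2 * κ * freqNormSq k : ℝ)) : ℂ) *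
        mFourierCoeff (fun x => (θ s x : ℂ)) k -
      ∑ j, (2 * Real.pi * I * (k j)) * mFourierCoeff (fun x => ((θ s x * u s x j : ℝ) : ℂ)) k +
        mFourierCoeff (fun x => (hs x : ℂ)) k)
    (hc : c = fun t k => mFourierCoeff (fun x => (θ₀ x : ℂ)) k + ∫ s in Ioc 0 t, B s k)
    (hsol : ∀ T, 0 < T → IsWeakScalarTransportForcedOn T κ u (fun _ => hs) θ₀ θ)
    (hhs : Integrable hs volume) (hθ₀ : Integrable θ₀ volume) {T : ℝ} (hT : 0 < T) {C : ℝ≥0}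
    (hC : ∀ᵐ t ∂(volume.restrict (Ioo 0 T)), ∫⁻ x, ‖θ t x‖ₑ ^ 2 ≤ C) :
    ∀ t ∈ Icc 0 T, ∀ N : ℕ, ∑ k ∈ freqBall N, ‖c t k‖ ^ 2 ≤ (C : ℝ) := by
  intro t ht N
  have hcont : ContinuousOn (fun t => ∑ k ∈ freqBall N, ‖c t k‖ ^ 2) (Icc 0 T) := by
    refine continuousOn_finsetSum _ fun k _ => ?_
    exact (((ssl_continuousOn_mode hB hc hsol k).mono Icc_subset_Ici_self).norm).pow 2
  have hae : ∀ᵐ t ∂(volume.restrict (Ioo 0 T)), ∑ k ∈ freqBall N, ‖c t k‖ ^ 2 ≤ (C : ℝ) := by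
    filter_upwards [ssl_ae_sum_sq_mode_le hB hc (hsol T hT) hhs hθ₀ hC] with t ht
    exact ht N
  exact ssl_le_of_ae_le_of_continuousOn hT hcont hae t ht

/-- **Square summability of the modes at every time**, with `∑ₖ ‖c(t,k)‖² ≤ C` on `[0, T]`
(bounded partial sums over the exhausting balls). [folklore] -/
theorem ssl_summable_sq_mode [DecidableEq d]
    (hB : B = fun s k => -(((4 * Real.pi ^ 2 * κ * freqNormSq k : ℝ)) : ℂ) *
        mFourierCoeff (fun x => (θ s x : ℂ)) k -
      ∑ j, (2 * Real.pi * I * (k j)) * mFourierCoeff (fun x => ((θ s x * u s x j : ℝ) : ℂ)) k +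
        mFourierCoeff (fun x => (hs x : ℂ)) k)
    (hc : c = fun t k => mFourierCoeff (fun x => (θ₀ x : ℂ)) k + ∫ s in Ioc 0 t, B s k)
    (hsol : ∀ T, 0 < T → IsWeakScalarTransportForcedOn T κ u (fun _ => hs) θ₀ θ)
    (hhs : Integrable hs volume) (hθ₀ : Integrable θ₀ volume) {T : ℝ} (hT : 0 < T) {C : ℝ≥0}
    (hC : ∀ᵐ t ∂(volume.restrict (Ioo 0 T)), ∫⁻ x, ‖θ t x‖ₑ ^ 2 ≤ C) {t : ℝ} (ht : t ∈ Icc 0 T) :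
    Summable (fun k : d → ℤ => ‖c t k‖ ^ 2) ∧ ∑' k : d → ℤ, ‖c t k‖ ^ 2 ≤ (C : ℝ) := by
  have hballs := ssl_sum_sq_mode_le hB hc hsol hhs hθ₀ hT hC t ht
  have hfin : ∀ s : Finset (d → ℤ), ∑ k ∈ s, ‖c t k‖ ^ 2 ≤ (C : ℝ) := by
    intro s
    obtain ⟨N, hN⟩ := (tendsto_atTop_atTop.1 tendsto_freqBall_atTop) s
    exact (Finset.sum_le_sum_of_subset_of_nonneg (hN N le_rfl) fun k _ _ => sq_nonneg _).trans
      (hballs N)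
  have hsum : Summable (fun k : d → ℤ => ‖c t k‖ ^ 2) := summable_of_sum_le (fun _ => sq_nonneg _) hfin
  exact ⟨hsum, hsum.tsum_le_of_sum_le hfin⟩

end Summit.AnomalousDissipation.AnomalousDissipation.Theorems

end
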